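import Summits.CriticalPhenomena.PercolationContinuityZ3.Theorems.PercNearOneGluingNoHeavyLowerTailSahiTangentPrincipalBottom

/-!
# `NoHeavyLowerTail` (crux stmt-CriticalPhenomena-4575), Sahi programme: the order-3 tangent inequality —
# **A UNIVERSAL LOWER BOUND `T₃ ≥ 2T + P − Σ_a w_a` AND THE THREE-NUMBER CRITERION** (what a proof for connection events would have to supply)

Support file (Sahi cell, seat `prim-sahi-p1`, generation 49; `--supports stmt-CriticalPhenomena-4575`).  Pure proofs, no definitions, no
`sorry`, standard axioms.  Companion of `…SahiTangentPrincipalBottom` / `…SahiTangentCondHarrisBottom` (same seat and generation).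

THE POINT.  The proof of the principal-bottom theorem splits into two halves.  HALF 1 uses only (H1) `Y ≤ X` and (H2) Harris for the tops —
valid for ANY three increasing events under ANY FKG weight on `Bool × α` — and gives the universal lower bound
  `T₃ ≥ 2T + P − (w_0 + w_1 + w_2)`,  `w_a := min( X_aY_{bc} , Y_aY_{bc} + (X_a − Y_a)X_bX_c )`,  `T = Y_{012}`, `P = X_0X_1X_2`
(`tangent13_ge_lowerBound`).  HALF 2 is the three-number lemma: `Σ_a w_a ≤ 2T + P` as soon as `w_a ≤ T + P` (⟸ (H3) Harris for the bottoms) and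
  (c)  `T·w_a + w_b·w_c ≤ T² + P·T`  for each slot `a`
(`tangent13_nonneg_of_threeNumber`; in `…PrincipalBottom` (c) is derived from (H4) conditional Harris).  So CONJECTURE T₃ FOR A GIVEN TRIPLE
FOLLOWS FROM THE THREE INEQUALITIES (c) ALONE (given H1–H3, which always hold).  Relevance (memo FROM-prim-sahi-p1-gen49-PRINCIPAL-BOTTOM-TANGENT
§4 and the seat's percolation probe): for the percolation instance R23 (coin = an edge `e`, events `s ↔ t_a`, bottoms = connections in `G − e`)
conditional Harris (H4) FAILS on ≈ 11 % of slots, but (c) held on every one of 15 000 + slots tested (tight only at independence) — (c) for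
connection events is therefore a candidate LOCAL form of R23.  `sahiE_three_sections_ge_of_threeNumber` is the lattice statement: two dominated
log-supermodular weights, ARBITRARY top and bottom up-sets, hypotheses (c) in mass form and `C₃ ≥ 0` for the bottoms ⟹ the contraction
inequality.  Nothing is asserted about R23 itself, Sahi's `C_n`, Kahn's conjecture or the increasing star. [this work]
-/

namespace Summit.CriticalPhenomena.PercolationContinuityZ3.Theorems.SahiTangent

open Finset Function Literature.Combinatorics.Sahi2008
open Literature.Probability.LatticeModels (mass mass_nonneg mass_mono mass_univ fkg_upperSet_mass latticeE3)
open scoped BigOperators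

noncomputable section

section Elementary

/-- **Half 1: the universal lower bound.**  Under (H1) `Y_a ≤ X_a`, `Y_{bc} ≤ X_{bc}` and (H2) `X_bX_c ≤ X_{bc}` only (all quantities
nonnegative), the tangent bracket is `≥ 2T + P − (w_0 + w_1 + w_2)` with `w_a = min(X_aY_{bc}, Y_aY_{bc} + (X_a − Y_a)X_bX_c)`. [this work] -/
theorem tangent13_ge_lowerBound {X₀ X₁ X₂ X₀₁ X₀₂ X₁₂ Y₀ Y₁ Y₂ Y₀₁ Y₀₂ Y₁₂ T : ℝ}
    (d₀ : Y₀ ≤ X₀) (d₁ : Y₁ ≤ X₁) (d₂ : Y₂ ≤ X₂) (d₀₁ : Y₀₁ ≤ X₀₁) (d₀₂ : Y₀₂ ≤ X₀₂) (d₁₂ : Y₁₂ ≤ X₁₂)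
    (c₀₁ : X₀ * X₁ ≤ X₀₁) (c₀₂ : X₀ * X₂ ≤ X₀₂) (c₁₂ : X₁ * X₂ ≤ X₁₂) :
    2 * T + X₀ * X₁ * X₂
        - (min (X₀ * Y₁₂) (Y₀ * Y₁₂ + (X₀ - Y₀) * (X₁ * X₂)) + min (X₁ * Y₀₂) (Y₁ * Y₀₂ + (X₁ - Y₁) * (X₀ * X₂))
            + min (X₂ * Y₀₁) (Y₂ * Y₀₁ + (X₂ - Y₂) * (X₀ * X₁))) ≤
      2 * T + (X₀ - Y₀) * X₁₂ + (X₁ - Y₁) * X₀₂ + (X₂ - Y₂) * X₀₁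
        + Y₀ * X₁ * X₂ + Y₁ * X₀ * X₂ + Y₂ * X₀ * X₁ - X₀ * Y₁₂ - X₁ * Y₀₂ - X₂ * Y₀₁ - 2 * X₀ * X₁ * X₂ := by
  set w₀ := min (X₀ * Y₁₂) (Y₀ * Y₁₂ + (X₀ - Y₀) * (X₁ * X₂)) with hw₀
  set w₁ := min (X₁ * Y₀₂) (Y₁ * Y₀₂ + (X₁ - Y₁) * (X₀ * X₂)) with hw₁
  set w₂ := min (X₂ * Y₀₁) (Y₂ * Y₀₁ + (X₂ - Y₂) * (X₀ * X₁)) with hw₂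
  have l₀ : X₀ * Y₁₂ - (X₀ - Y₀) * (X₁₂ - X₁ * X₂) ≤ w₀ := by
    refine le_min ?_ ?_
    · linarith [mul_nonneg (sub_nonneg.2 d₀) (sub_nonneg.2 c₁₂)]
    · linarith [mul_nonneg (sub_nonneg.2 d₀) (sub_nonneg.2 d₁₂)]
  have l₁ : X₁ * Y₀₂ - (X₁ - Y₁) * (X₀₂ - X₀ * X₂) ≤ w₁ := by
    refine le_min ?_ ?_
    · linarith [mul_nonneg (sub_nonneg.2 d₁) (sub_nonneg.2 c₀₂)]
    · linarith [mul_nonneg (sub_nonneg.2 d₁) (sub_nonneg.2 d₀₂)]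
  have l₂ : X₂ * Y₀₁ - (X₂ - Y₂) * (X₀₁ - X₀ * X₁) ≤ w₂ := by
    refine le_min ?_ ?_
    · linarith [mul_nonneg (sub_nonneg.2 d₂) (sub_nonneg.2 c₀₁)]
    · linarith [mul_nonneg (sub_nonneg.2 d₂) (sub_nonneg.2 d₀₁)]
  linarith [l₀, l₁, l₂]

/-- **Half 2: the three-number criterion.**  (H1), (H2), (H3) `Y_a·Y_{bc} ≤ T` and, for each slot, the inequality
(c) `T·w_a + w_b·w_c ≤ T² + P·T` (with the `w_a` of `tangent13_ge_lowerBound`, `P = X_0X_1X_2`) imply that the tangent bracket is `≥ 0`.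
(In `tangent13_nonneg` (c) is DERIVED from conditional Harris (H4); for percolation connection events (H4) fails but (c) appears to hold.)
[this work] -/
theorem tangent13_nonneg_of_threeNumber {X₀ X₁ X₂ X₀₁ X₀₂ X₁₂ Y₀ Y₁ Y₂ Y₀₁ Y₀₂ Y₁₂ T : ℝ}
    (hX₀ : 0 ≤ X₀) (hX₁ : 0 ≤ X₁) (hX₂ : 0 ≤ X₂) (hY₀ : 0 ≤ Y₀) (hY₁ : 0 ≤ Y₁) (hY₂ : 0 ≤ Y₂)
    (hY₀₁ : 0 ≤ Y₀₁) (hY₀₂ : 0 ≤ Y₀₂) (hY₁₂ : 0 ≤ Y₁₂) (hT : 0 ≤ T)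
    (d₀ : Y₀ ≤ X₀) (d₁ : Y₁ ≤ X₁) (d₂ : Y₂ ≤ X₂) (d₀₁ : Y₀₁ ≤ X₀₁) (d₀₂ : Y₀₂ ≤ X₀₂) (d₁₂ : Y₁₂ ≤ X₁₂)
    (c₀₁ : X₀ * X₁ ≤ X₀₁) (c₀₂ : X₀ * X₂ ≤ X₀₂) (c₁₂ : X₁ * X₂ ≤ X₁₂)
    (b₀ : Y₀ * Y₁₂ ≤ T) (b₁ : Y₁ * Y₀₂ ≤ T) (b₂ : Y₂ * Y₀₁ ≤ T)
    (t₀ : T * min (X₀ * Y₁₂) (Y₀ * Y₁₂ + (X₀ - Y₀) * (X₁ * X₂))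
        + min (X₁ * Y₀₂) (Y₁ * Y₀₂ + (X₁ - Y₁) * (X₀ * X₂)) * min (X₂ * Y₀₁) (Y₂ * Y₀₁ + (X₂ - Y₂) * (X₀ * X₁))
        ≤ T ^ 2 + (X₀ * X₁ * X₂) * T)
    (t₁ : T * min (X₁ * Y₀₂) (Y₁ * Y₀₂ + (X₁ - Y₁) * (X₀ * X₂))
        + min (X₀ * Y₁₂) (Y₀ * Y₁₂ + (X₀ - Y₀) * (X₁ * X₂)) * min (X₂ * Y₀₁) (Y₂ * Y₀₁ + (X₂ - Y₂) * (X₀ * X₁))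
        ≤ T ^ 2 + (X₀ * X₁ * X₂) * T)
    (t₂ : T * min (X₂ * Y₀₁) (Y₂ * Y₀₁ + (X₂ - Y₂) * (X₀ * X₁))
        + min (X₀ * Y₁₂) (Y₀ * Y₁₂ + (X₀ - Y₀) * (X₁ * X₂)) * min (X₁ * Y₀₂) (Y₁ * Y₀₂ + (X₁ - Y₁) * (X₀ * X₂))
        ≤ T ^ 2 + (X₀ * X₁ * X₂) * T) :
    0 ≤ 2 * T + (X₀ - Y₀) * X₁₂ + (X₁ - Y₁) * X₀₂ + (X₂ - Y₂) * X₀₁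
        + Y₀ * X₁ * X₂ + Y₁ * X₀ * X₂ + Y₂ * X₀ * X₁ - X₀ * Y₁₂ - X₁ * Y₀₂ - X₂ * Y₀₁ - 2 * X₀ * X₁ * X₂ := by
  have hlb := tangent13_ge_lowerBound (T := T) d₀ d₁ d₂ d₀₁ d₀₂ d₁₂ c₀₁ c₀₂ c₁₂
  set w₀ := min (X₀ * Y₁₂) (Y₀ * Y₁₂ + (X₀ - Y₀) * (X₁ * X₂)) with hw₀
  set w₁ := min (X₁ * Y₀₂) (Y₁ * Y₀₂ + (X₁ - Y₁) * (X₀ * X₂)) with hw₁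
  set w₂ := min (X₂ * Y₀₁) (Y₂ * Y₀₁ + (X₂ - Y₂) * (X₀ * X₁)) with hw₂
  have n₀ : 0 ≤ w₀ :=
    le_min (mul_nonneg hX₀ hY₁₂) (add_nonneg (mul_nonneg hY₀ hY₁₂) (mul_nonneg (sub_nonneg.2 d₀) (mul_nonneg hX₁ hX₂)))
  have n₁ : 0 ≤ w₁ :=
    le_min (mul_nonneg hX₁ hY₀₂) (add_nonneg (mul_nonneg hY₁ hY₀₂) (mul_nonneg (sub_nonneg.2 d₁) (mul_nonneg hX₀ hX₂)))
  have n₂ : 0 ≤ w₂ :=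
    le_min (mul_nonneg hX₂ hY₀₁) (add_nonneg (mul_nonneg hY₂ hY₀₁) (mul_nonneg (sub_nonneg.2 d₂) (mul_nonneg hX₀ hX₁)))
  have u₀b : w₀ ≤ Y₀ * Y₁₂ + (X₀ - Y₀) * (X₁ * X₂) := min_le_right _ _
  have u₁b : w₁ ≤ Y₁ * Y₀₂ + (X₁ - Y₁) * (X₀ * X₂) := min_le_right _ _
  have u₂b : w₂ ≤ Y₂ * Y₀₁ + (X₂ - Y₂) * (X₀ * X₁) := min_le_right _ _
  have e₀ : w₀ ≤ T + X₀ * X₁ * X₂ := by linarith [u₀b, b₀, mul_nonneg hY₀ (mul_nonneg hX₁ hX₂)]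
  have e₁ : w₁ ≤ T + X₀ * X₁ * X₂ := by linarith [u₁b, b₁, mul_nonneg hY₁ (mul_nonneg hX₀ hX₂)]
  have e₂ : w₂ ≤ T + X₀ * X₁ * X₂ := by linarith [u₂b, b₂, mul_nonneg hY₂ (mul_nonneg hX₀ hX₁)]
  have key := three_number_lemma hT n₀ n₁ n₂ e₀ e₁ e₂ t₀ t₁ t₂
  linarith [hlb, key]

end Elementary

/-! ### The lattice statement with (c) as hypotheses -/

section Lattice

variable {α : Type*} [DistribLattice α] [Fintype α] [DecidableEq α]

/-- **The contraction inequality from the three-number criterion.**  Two nonnegative log-supermodular probability weights `ν₀ ≼ ν₁` on a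
finite distributive lattice; ARBITRARY top up-sets `U ⊇ U₀`, `V ⊇ V₀`, `W ⊇ W₀` and bottom up-sets `U₀, V₀, W₀`; hypotheses: `C₃ ≥ 0` for the
bottoms under `ν₀` (`hc₀`) and the three inequalities (c) in mass form (`t₀ t₁ t₂`, with `X_S = ν₁(tops)`, `Y_S = ν₀(bottoms)`).  Then
`p · E₃^{ν₁}(χ_U,χ_V,χ_W) ≤ E₃^{(p·ν₁,(1−p)·ν₀)}(F_U,F_V,F_W)` for every `p ∈ [0,1]`. [this work] -/
theorem sahiE_three_sections_ge_of_threeNumber {ν₀ ν₁ : α → ℝ} (h₀ : 0 ≤ ν₀)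
    (hl₀ : ∀ a b, ν₀ a * ν₀ b ≤ ν₀ (a ⊓ b) * ν₀ (a ⊔ b)) (hZ₀ : ∑ x, ν₀ x = 1) (h₁ : 0 ≤ ν₁)
    (hl₁ : ∀ a b, ν₁ a * ν₁ b ≤ ν₁ (a ⊓ b) * ν₁ (a ⊔ b)) (hZ₁ : ∑ x, ν₁ x = 1)
    (hdom : ∀ A : Finset α, IsUpperSet (A : Set α) → mass ν₀ A ≤ mass ν₁ A)
    {U V W U₀ V₀ W₀ : Finset α} (hU : IsUpperSet (U : Set α)) (hV : IsUpperSet (V : Set α)) (hW : IsUpperSet (W : Set α))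
    (hU₀ : IsUpperSet (U₀ : Set α)) (hV₀ : IsUpperSet (V₀ : Set α)) (hW₀ : IsUpperSet (W₀ : Set α))
    (huU : U₀ ⊆ U) (hvV : V₀ ⊆ V) (hwW : W₀ ⊆ W)
    (hc₀ : 0 ≤ latticeE3 ν₀ U₀ V₀ W₀)
    (t₀ : mass ν₀ (U₀ ∩ V₀ ∩ W₀) * min (mass ν₁ U * mass ν₀ (V₀ ∩ W₀))
          (mass ν₀ U₀ * mass ν₀ (V₀ ∩ W₀) + (mass ν₁ U - mass ν₀ U₀) * (mass ν₁ V * mass ν₁ W))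
        + min (mass ν₁ V * mass ν₀ (U₀ ∩ W₀)) (mass ν₀ V₀ * mass ν₀ (U₀ ∩ W₀) + (mass ν₁ V - mass ν₀ V₀) * (mass ν₁ U * mass ν₁ W))
          * min (mass ν₁ W * mass ν₀ (U₀ ∩ V₀)) (mass ν₀ W₀ * mass ν₀ (U₀ ∩ V₀) + (mass ν₁ W - mass ν₀ W₀) * (mass ν₁ U * mass ν₁ V))
        ≤ mass ν₀ (U₀ ∩ V₀ ∩ W₀) ^ 2 + (mass ν₁ U * mass ν₁ V * mass ν₁ W) * mass ν₀ (U₀ ∩ V₀ ∩ W₀))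
    (t₁ : mass ν₀ (U₀ ∩ V₀ ∩ W₀) * min (mass ν₁ V * mass ν₀ (U₀ ∩ W₀))
          (mass ν₀ V₀ * mass ν₀ (U₀ ∩ W₀) + (mass ν₁ V - mass ν₀ V₀) * (mass ν₁ U * mass ν₁ W))
        + min (mass ν₁ U * mass ν₀ (V₀ ∩ W₀)) (mass ν₀ U₀ * mass ν₀ (V₀ ∩ W₀) + (mass ν₁ U - mass ν₀ U₀) * (mass ν₁ V * mass ν₁ W))
          * min (mass ν₁ W * mass ν₀ (U₀ ∩ V₀)) (mass ν₀ W₀ * mass ν₀ (U₀ ∩ V₀) + (mass ν₁ W - mass ν₀ W₀) * (mass ν₁ U * mass ν₁ V))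
        ≤ mass ν₀ (U₀ ∩ V₀ ∩ W₀) ^ 2 + (mass ν₁ U * mass ν₁ V * mass ν₁ W) * mass ν₀ (U₀ ∩ V₀ ∩ W₀))
    (t₂ : mass ν₀ (U₀ ∩ V₀ ∩ W₀) * min (mass ν₁ W * mass ν₀ (U₀ ∩ V₀))
          (mass ν₀ W₀ * mass ν₀ (U₀ ∩ V₀) + (mass ν₁ W - mass ν₀ W₀) * (mass ν₁ U * mass ν₁ V))
        + min (mass ν₁ U * mass ν₀ (V₀ ∩ W₀)) (mass ν₀ U₀ * mass ν₀ (V₀ ∩ W₀) + (mass ν₁ U - mass ν₀ U₀) * (mass ν₁ V * mass ν₁ W))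
          * min (mass ν₁ V * mass ν₀ (U₀ ∩ W₀)) (mass ν₀ V₀ * mass ν₀ (U₀ ∩ W₀) + (mass ν₁ V - mass ν₀ V₀) * (mass ν₁ U * mass ν₁ W))
        ≤ mass ν₀ (U₀ ∩ V₀ ∩ W₀) ^ 2 + (mass ν₁ U * mass ν₁ V * mass ν₁ W) * mass ν₀ (U₀ ∩ V₀ ∩ W₀))
    {p : ℝ} (hp₀ : 0 ≤ p) (hp₁ : p ≤ 1) :
    p * sahiE ν₁ 3 ![setInd U, setInd V, setInd W] ≤
      sahiE (fun z : Bool × α => if z.1 then p * ν₁ z.2 else (1 - p) * ν₀ z.2) 3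
        ![fun z => if z.1 then setInd U z.2 else setInd U₀ z.2,
          fun z => if z.1 then setInd V z.2 else setInd V₀ z.2,
          fun z => if z.1 then setInd W z.2 else setInd W₀ z.2] := by
  have key := sahiE_three_sections ν₀ ν₁ p
    ![fun z => if z.1 then setInd U z.2 else setInd U₀ z.2,
      fun z => if z.1 then setInd V z.2 else setInd V₀ z.2,
      fun z => if z.1 then setInd W z.2 else setInd W₀ z.2]
  simp only [Matrix.cons_val_zero, Matrix.cons_val_one, Matrix.cons_val_two, Matrix.head_cons, Matrix.tail_cons,
    if_true, if_false, Bool.false_eq_true] at key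
  have e0 : (fun x => setInd U x) = setInd U := rfl
  have e1 : (fun x => setInd V x) = setInd V := rfl
  have e2 : (fun x => setInd W x) = setInd W := rfl
  have e3 : (fun x => setInd U₀ x) = setInd U₀ := rfl
  have e4 : (fun x => setInd V₀ x) = setInd V₀ := rfl
  have e5 : (fun x => setInd W₀ x) = setInd W₀ := rfl
  have m1 : (fun x => setInd U₀ x * setInd V₀ x * setInd W₀ x) = setInd U₀ * setInd V₀ * setInd W₀ := rfl
  have m2 : (fun x => setInd V x * setInd W x) = setInd V * setInd W := rfl
  have m3 : (fun x => setInd U x * setInd W x) = setInd U * setInd W := rfl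
  have m4 : (fun x => setInd U x * setInd V x) = setInd U * setInd V := rfl
  have m5 : (fun x => setInd V₀ x * setInd W₀ x) = setInd V₀ * setInd W₀ := rfl
  have m6 : (fun x => setInd U₀ x * setInd W₀ x) = setInd U₀ * setInd W₀ := rfl
  have m7 : (fun x => setInd U₀ x * setInd V₀ x) = setInd U₀ * setInd V₀ := rfl
  rw [e0, e1, e2, e3, e4, e5, m1, m2, m3, m4, m5, m6, m7] at key
  simp only [setInd_mul, ex_setInd] at key
  have hZ₀' : mass ν₀ univ = 1 := by rw [mass_univ]; exact hZ₀
  have hZ₁' : mass ν₁ univ = 1 := by rw [mass_univ]; exact hZ₁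
  have huv : IsUpperSet ((U₀ ∩ V₀ : Finset α) : Set α) := by rw [Finset.coe_inter]; exact hU₀.inter hV₀
  have huw : IsUpperSet ((U₀ ∩ W₀ : Finset α) : Set α) := by rw [Finset.coe_inter]; exact hU₀.inter hW₀
  have hvw : IsUpperSet ((V₀ ∩ W₀ : Finset α) : Set α) := by rw [Finset.coe_inter]; exact hV₀.inter hW₀
  -- (H1)
  have d₀ : mass ν₀ U₀ ≤ mass ν₁ U := (hdom _ hU₀).trans (mass_mono h₁ huU)
  have d₁ : mass ν₀ V₀ ≤ mass ν₁ V := (hdom _ hV₀).trans (mass_mono h₁ hvV)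
  have d₂ : mass ν₀ W₀ ≤ mass ν₁ W := (hdom _ hW₀).trans (mass_mono h₁ hwW)
  have d₀₁ : mass ν₀ (U₀ ∩ V₀) ≤ mass ν₁ (U ∩ V) := (hdom _ huv).trans (mass_mono h₁ (Finset.inter_subset_inter huU hvV))
  have d₀₂ : mass ν₀ (U₀ ∩ W₀) ≤ mass ν₁ (U ∩ W) := (hdom _ huw).trans (mass_mono h₁ (Finset.inter_subset_inter huU hwW))
  have d₁₂ : mass ν₀ (V₀ ∩ W₀) ≤ mass ν₁ (V ∩ W) := (hdom _ hvw).trans (mass_mono h₁ (Finset.inter_subset_inter hvV hwW))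
  -- (H2)
  have c₀₁ : mass ν₁ U * mass ν₁ V ≤ mass ν₁ (U ∩ V) := by
    have h := fkg_upperSet_mass h₁ hl₁ hU hV
    rw [hZ₁', one_mul] at h; exact h
  have c₀₂ : mass ν₁ U * mass ν₁ W ≤ mass ν₁ (U ∩ W) := by
    have h := fkg_upperSet_mass h₁ hl₁ hU hW
    rw [hZ₁', one_mul] at h; exact h
  have c₁₂ : mass ν₁ V * mass ν₁ W ≤ mass ν₁ (V ∩ W) := by
    have h := fkg_upperSet_mass h₁ hl₁ hV hW
    rw [hZ₁', one_mul] at h; exact h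
  -- (H3)
  have b₀ : mass ν₀ U₀ * mass ν₀ (V₀ ∩ W₀) ≤ mass ν₀ (U₀ ∩ V₀ ∩ W₀) := by
    have h := fkg_upperSet_mass h₀ hl₀ hU₀ hvw
    rw [hZ₀', one_mul, ← Finset.inter_assoc] at h; exact h
  have b₁ : mass ν₀ V₀ * mass ν₀ (U₀ ∩ W₀) ≤ mass ν₀ (U₀ ∩ V₀ ∩ W₀) := by
    have h := fkg_upperSet_mass h₀ hl₀ hV₀ huw
    rw [hZ₀', one_mul, Finset.inter_left_comm, ← Finset.inter_assoc] at h; exact h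
  have b₂ : mass ν₀ W₀ * mass ν₀ (U₀ ∩ V₀) ≤ mass ν₀ (U₀ ∩ V₀ ∩ W₀) := by
    have h := fkg_upperSet_mass h₀ hl₀ hW₀ huv
    rw [hZ₀', one_mul, Finset.inter_comm W₀ (U₀ ∩ V₀)] at h; exact h
  have hT := tangent13_nonneg_of_threeNumber (mass_nonneg h₁ U) (mass_nonneg h₁ V) (mass_nonneg h₁ W) (mass_nonneg h₀ _)
    (mass_nonneg h₀ _) (mass_nonneg h₀ _) (mass_nonneg h₀ _) (mass_nonneg h₀ _) (mass_nonneg h₀ _) (mass_nonneg h₀ _)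
    d₀ d₁ d₂ d₀₁ d₀₂ d₁₂ c₀₁ c₀₂ c₁₂ b₀ b₁ b₂ t₀ t₁ t₂
  have hc₀' : 0 ≤ sahiE ν₀ 3 ![setInd U₀, setInd V₀, setInd W₀] := by
    rw [sahiE_three_indicator_eq_latticeE3 hZ₀]; exact hc₀
  have hD : 0 ≤ (mass ν₁ U - mass ν₀ U₀) * (mass ν₁ V - mass ν₀ V₀) * (mass ν₁ W - mass ν₀ W₀) :=
    mul_nonneg (mul_nonneg (sub_nonneg.2 d₀) (sub_nonneg.2 d₁)) (sub_nonneg.2 d₂)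
  have h1p : 0 ≤ 1 - p := sub_nonneg.2 hp₁
  nlinarith [key, mul_nonneg h1p (mul_nonneg h1p hc₀'), mul_nonneg h1p (mul_nonneg hp₀ hT),
    mul_nonneg h1p (mul_nonneg (mul_nonneg hp₀ h1p) hD)]

end Lattice

end

end Summit.CriticalPhenomena.PercolationContinuityZ3.Theorems.SahiTangent
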